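import Literature.NumberTheory.Automorphic.SymplecticSimilitudeCartanDecomposition
import Literature.NumberTheory.Automorphic.GelfandPair
import HarnessLib

/-!
# The symplectic similitude group `GSp(J, K) ≤ GL_{2l}(K)`, its hyperspecial subgroup `GSp(J, 𝒪)`, and the Gelfand
# pair `(GSp(J, K), GSp(J, 𝒪))`: the spherical Hecke algebra of `GSp` is commutative

Topic `NumberTheory/Automorphic`; namespace `Literature.NumberTheory.Automorphic.SymplecticCartan` (lane `lit-hodgefound`,
Track 2 foundations; seat `lit-hodgefound-p11`, generation 34, row g34-#4, file 10).  DEFINITIONS (with bodies) + theorems: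
`transposeGL`, `contragredientGL` (`g ↦ (g⁻¹)ᵀ` on `GL`), `symplecticSimilitudeGroup l K ≤ GL (l ⊕ l) K` (`GSp(J, K)`:
`gᵀ J g = μ J`, `μ ≠ 0`), `contragredientGSp` (the contragredient automorphism of `GSp`), `ofSymplectic` (`Sp(J, K) →* GSp(J, K)`),
`symplecticSimilitudeInt` (`GSp(J, 𝒪)`: entries of `g` and `g⁻¹` integral); no named fact, no instance, no notation.

## The print

[AndrianovZhuravlev1995] Ch. 3 §3 (held text `galaxy-panama-466270239588381`, chars 369500–381637): `Sⁿ = GSp_n⁺(ℚ) ∩ M_{2n}(ℤ)`,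
`Γⁿ = Sp_n(ℤ)`, Lemma 3.6 (symplectic divisors) and «THEOREM 3.7. For `n, q ∈ ℕ` the ring `Lⁿ(q)` is commutative», proved
with the anti-automorphism induced by transposition (`(M)_Γ ↦ (ᵗM)_Γ`, «`sd(ᵗM) = sd(M)`», and the `J_n M J_n⁻¹` remark); the
local statement for `G = GSp` at a hyperspecial place is the commutativity input of [Kottwitz1992] §7 and the Satake
isomorphism [Tits1979] §3.3.3 / Cartier.  Abstract Gelfand lemma: the tree's `isGelfandPair_of_mulEquiv` (weakly symmetric
pairs: `g⁻¹ ∈ K θ(g) K` for an automorphism `θ`) [CeccherinisilbersteScarabottiTolli2018, Ex. 13.3.9], here with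
`θ = ` contragredient `g ↦ (gᵀ)⁻¹`, i.e. `g ∈ K gᵀ K`.

## What is formalised (`K` a field, `l` a finite index type; `Valued K ℤᵐ⁰` with a uniformiser for §4)

* §1 `transposeGL`, `contragredientGL : GL n K ≃* GL n K` and their algebra.
* §2 `symplecticSimilitudeGroup` (`GSp(J, K)`), `mem_symplecticSimilitudeGroup_iff`, the row identity
  `mul_J_mul_transpose_of_eq` (`g J gᵀ = μ J`), `transposeGL_mem`, `contragredientGL_mem`, `contragredientGSp`,
  `ofSymplectic : symplecticGroup l K →* GSp(J, K)`.
* §3 `symplecticSimilitudeInt` (`GSp(J, 𝒪)`), `ofSymplectic_mem_symplecticSimilitudeInt`, `transposeGL` preserves it.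
* §4 **`inv_mem_doubleCoset_contragredient`** — every `g ∈ GSp(J, K)` has `g⁻¹ ∈ GSp(J, 𝒪) (gᵀ)⁻¹ GSp(J, 𝒪)` (equivalently
  `gᵀ ∈ GSp(J, 𝒪) g GSp(J, 𝒪)`; from the Cartan decomposition `g = k₁ T k₂` of file 9 with `T` diagonal);
  **`isGelfandPair_symplecticSimilitudeInt`** — `ℋ(GSp(J, K), GSp(J, 𝒪))` is commutative.

## References
* [AndrianovZhuravlev1995] A. N. Andrianov, V. G. Zhuravlev, *Modular Forms and Hecke Operators* (1995), Ch. 3 §3, Lemma 3.6,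
  Theorem 3.7.
* [Kottwitz1992] R. E. Kottwitz, J. AMS 5 (1992), §7.
* [Tits1979] J. Tits, *Reductive groups over local fields*, Proc. Symp. Pure Math. 33.1 (1979), §3.3.3.
* [CeccherinisilbersteScarabottiTolli2018] T. Ceccherini-Silberstein, F. Scarabotti, F. Tolli (2018), Ex. 13.3.9, Cor. 13.3.6.
-/

noncomputable section

open scoped Valued WithZero MatrixGroups
open Matrix

namespace Literature.NumberTheory.Automorphic.SymplecticCartan

variable {K : Type*} [Field K] {n : Type*} [Fintype n] [DecidableEq n] {l : Type*} [Fintype l] [DecidableEq l]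

/-! ## §1 Transpose and contragredient on `GL` -/

/-- The transpose of an invertible matrix, as an element of `GL`. [cite: AndrianovZhuravlev1995, Ch. 3 §3] -/
def transposeGL (g : GL n K) : GL n K :=
  ⟨(g : Matrix n n K)ᵀ, ((g⁻¹ : GL n K) : Matrix n n K)ᵀ,
    by rw [← Matrix.transpose_mul, ← Units.val_mul, inv_mul_cancel, Units.val_one, Matrix.transpose_one],
    by rw [← Matrix.transpose_mul, ← Units.val_mul, mul_inv_cancel, Units.val_one, Matrix.transpose_one]⟩

/-- The matrix of `transposeGL g` is `gᵀ`. [cite: AndrianovZhuravlev1995, Ch. 3 §3] -/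
@[simp] theorem coe_transposeGL (g : GL n K) : ((transposeGL g : GL n K) : Matrix n n K) = (g : Matrix n n K)ᵀ := rfl

/-- `(g h)ᵀ = hᵀ gᵀ`. [cite: AndrianovZhuravlev1995, Ch. 3 §3] -/
theorem transposeGL_mul (g h : GL n K) : transposeGL (g * h) = transposeGL h * transposeGL g :=
  Units.ext (by rw [coe_transposeGL, Units.val_mul, Matrix.transpose_mul, Units.val_mul, coe_transposeGL, coe_transposeGL])

/-- `(gᵀ)ᵀ = g`. [cite: AndrianovZhuravlev1995, Ch. 3 §3] -/
theorem transposeGL_transposeGL (g : GL n K) : transposeGL (transposeGL g) = g :=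
  Units.ext (by rw [coe_transposeGL, coe_transposeGL, Matrix.transpose_transpose])

/-- `(g⁻¹)ᵀ = (gᵀ)⁻¹`. [cite: AndrianovZhuravlev1995, Ch. 3 §3] -/
theorem transposeGL_inv (g : GL n K) : transposeGL g⁻¹ = (transposeGL g)⁻¹ :=
  Units.ext rfl

/-- `1ᵀ = 1`. [cite: AndrianovZhuravlev1995, Ch. 3 §3] -/
theorem transposeGL_one : transposeGL (1 : GL n K) = 1 :=
  Units.ext (by rw [coe_transposeGL, Units.val_one, Matrix.transpose_one])

/-- **The contragredient automorphism `g ↦ (g⁻¹)ᵀ` of `GL`** (an involutive group automorphism).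
[cite: AndrianovZhuravlev1995, Ch. 3 §3] -/
def contragredientGL : GL n K ≃* GL n K where
  toFun g := transposeGL g⁻¹
  invFun g := transposeGL g⁻¹
  left_inv g := by
    show transposeGL (transposeGL g⁻¹)⁻¹ = g
    rw [← transposeGL_inv, inv_inv, transposeGL_transposeGL]
  right_inv g := by
    show transposeGL (transposeGL g⁻¹)⁻¹ = g
    rw [← transposeGL_inv, inv_inv, transposeGL_transposeGL]
  map_mul' g h := by
    show transposeGL (g * h)⁻¹ = transposeGL g⁻¹ * transposeGL h⁻¹
    rw [_root_.mul_inv_rev, transposeGL_mul]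

/-- `contragredientGL g = (g⁻¹)ᵀ` as a matrix. [cite: AndrianovZhuravlev1995, Ch. 3 §3] -/
theorem coe_contragredientGL (g : GL n K) :
    ((contragredientGL g : GL n K) : Matrix n n K) = (((g⁻¹ : GL n K)) : Matrix n n K)ᵀ := rfl

/-- `contragredientGL g = (gᵀ)⁻¹`. [cite: AndrianovZhuravlev1995, Ch. 3 §3] -/
theorem contragredientGL_eq (g : GL n K) : contragredientGL g = (transposeGL g)⁻¹ :=
  transposeGL_inv g

/-! ## §2 The symplectic similitude group `GSp(J, K)` -/

/-- **`GSp(J, K)`** — the group of symplectic similitudes: invertible `g` with `gᵀ J g = μ J` for some `μ ≠ 0` (the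
multiplier), `J = (0 -1; 1 0)`; a subgroup of `GL_{l ⊔ l}(K)`. [cite: AndrianovZhuravlev1995, Ch. 3 §3 (the group `Sⁿ = GSp_n⁺`);
Kottwitz1992, §7 (Case C)] -/
def symplecticSimilitudeGroup (l K : Type*) [Field K] [Fintype l] [DecidableEq l] : Subgroup (GL (l ⊕ l) K) where
  carrier := {g | ∃ μ : K, μ ≠ 0 ∧ (g : Matrix (l ⊕ l) (l ⊕ l) K)ᵀ * J l K * (g : Matrix (l ⊕ l) (l ⊕ l) K) = μ • J l K}
  one_mem' := ⟨1, one_ne_zero, by rw [Units.val_one, Matrix.transpose_one, Matrix.one_mul, Matrix.mul_one, one_smul]⟩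
  mul_mem' := by
    rintro g h ⟨μ, hμ, hg⟩ ⟨ν, hν, hh⟩
    refine ⟨μ * ν, mul_ne_zero hμ hν, ?_⟩
    rw [Units.val_mul, Matrix.transpose_mul]
    calc (h : Matrix (l ⊕ l) (l ⊕ l) K)ᵀ * (g : Matrix (l ⊕ l) (l ⊕ l) K)ᵀ * J l K *
          ((g : Matrix (l ⊕ l) (l ⊕ l) K) * (h : Matrix (l ⊕ l) (l ⊕ l) K))
        = (h : Matrix (l ⊕ l) (l ⊕ l) K)ᵀ *
            ((g : Matrix (l ⊕ l) (l ⊕ l) K)ᵀ * J l K * (g : Matrix (l ⊕ l) (l ⊕ l) K)) *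
            (h : Matrix (l ⊕ l) (l ⊕ l) K) := by simp only [Matrix.mul_assoc]
      _ = (μ * ν) • J l K := by rw [hg, Matrix.mul_smul, Matrix.smul_mul, hh, smul_smul]
  inv_mem' := by
    rintro g ⟨μ, hμ, hg⟩
    refine ⟨μ⁻¹, inv_ne_zero hμ, ?_⟩
    have hJ : J l K = μ⁻¹ • ((g : Matrix (l ⊕ l) (l ⊕ l) K)ᵀ * J l K * (g : Matrix (l ⊕ l) (l ⊕ l) K)) := by
      rw [hg, smul_smul, inv_mul_cancel₀ hμ, one_smul]
    calc ((g⁻¹ : GL (l ⊕ l) K) : Matrix (l ⊕ l) (l ⊕ l) K)ᵀ * J l K * ((g⁻¹ : GL (l ⊕ l) K) : Matrix (l ⊕ l) (l ⊕ l) K)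
        = ((g⁻¹ : GL (l ⊕ l) K) : Matrix (l ⊕ l) (l ⊕ l) K)ᵀ *
            (μ⁻¹ • ((g : Matrix (l ⊕ l) (l ⊕ l) K)ᵀ * J l K * (g : Matrix (l ⊕ l) (l ⊕ l) K))) *
            ((g⁻¹ : GL (l ⊕ l) K) : Matrix (l ⊕ l) (l ⊕ l) K) := by rw [← hJ]
      _ = μ⁻¹ • (((g : Matrix (l ⊕ l) (l ⊕ l) K) * ((g⁻¹ : GL (l ⊕ l) K) : Matrix (l ⊕ l) (l ⊕ l) K))ᵀ * J l K *
            ((g : Matrix (l ⊕ l) (l ⊕ l) K) * ((g⁻¹ : GL (l ⊕ l) K) : Matrix (l ⊕ l) (l ⊕ l) K))) := by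
          rw [Matrix.transpose_mul, Matrix.mul_smul, Matrix.smul_mul]
          congr 1
          simp only [Matrix.mul_assoc]
      _ = μ⁻¹ • J l K := by
          rw [← Units.val_mul, mul_inv_cancel, Units.val_one, Matrix.transpose_one, Matrix.one_mul, Matrix.mul_one]

/-- Membership in `GSp(J, K)`. [cite: AndrianovZhuravlev1995, Ch. 3 §3] -/
theorem mem_symplecticSimilitudeGroup_iff {g : GL (l ⊕ l) K} :
    g ∈ symplecticSimilitudeGroup l K ↔
      ∃ μ : K, μ ≠ 0 ∧ (g : Matrix (l ⊕ l) (l ⊕ l) K)ᵀ * J l K * (g : Matrix (l ⊕ l) (l ⊕ l) K) = μ • J l K :=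
  Iff.rfl

/-- **The row identity**: a similitude with `gᵀ J g = μ J` also satisfies `g J gᵀ = μ J`. [cite: AndrianovZhuravlev1995, Ch. 3 §3 (3.1)–(3.2)] -/
theorem mul_J_mul_transpose_of_eq (g : GL (l ⊕ l) K) {μ : K}
    (hg : (g : Matrix (l ⊕ l) (l ⊕ l) K)ᵀ * J l K * (g : Matrix (l ⊕ l) (l ⊕ l) K) = μ • J l K) :
    (g : Matrix (l ⊕ l) (l ⊕ l) K) * J l K * (g : Matrix (l ⊕ l) (l ⊕ l) K)ᵀ = μ • J l K := by
  set A : Matrix (l ⊕ l) (l ⊕ l) K := ((g : GL (l ⊕ l) K) : Matrix (l ⊕ l) (l ⊕ l) K) with hA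
  set Ai : Matrix (l ⊕ l) (l ⊕ l) K := ((g⁻¹ : GL (l ⊕ l) K) : Matrix (l ⊕ l) (l ⊕ l) K) with hAi
  have hAAi : A * Ai = 1 := by rw [hA, hAi, ← Units.val_mul, mul_inv_cancel, Units.val_one]
  have hAiA : Ai * A = 1 := by rw [hA, hAi, ← Units.val_mul, inv_mul_cancel, Units.val_one]
  -- `(A J Aᵀ J) A = A J (Aᵀ J A) = μ A J J = -μ A`
  have h1 : A * J l K * Aᵀ * J l K * A = -(μ • A) := by
    calc A * J l K * Aᵀ * J l K * A = A * J l K * (Aᵀ * J l K * A) := by simp only [Matrix.mul_assoc]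
      _ = -(μ • A) := by
        rw [hg, Matrix.mul_smul, Matrix.mul_assoc, Matrix.J_squared, Matrix.mul_neg, Matrix.mul_one, smul_neg]
  -- cancel `A` on the right and `J` (`J² = -1`)
  have h2 : A * J l K * Aᵀ * J l K = -(μ • (1 : Matrix (l ⊕ l) (l ⊕ l) K)) := by
    have := congrArg (· * Ai) h1
    simpa only [Matrix.mul_assoc, hAAi, Matrix.mul_one, Matrix.neg_mul, Matrix.smul_mul] using this
  have h3 := congrArg (· * J l K) h2
  simp only [Matrix.mul_assoc, Matrix.J_squared, Matrix.mul_neg, Matrix.mul_one, Matrix.neg_mul, Matrix.smul_mul,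
    Matrix.one_mul] at h3
  -- `h3 : -(A * (J * Aᵀ)) = -(μ • J)` up to normalisation
  have h4 : A * J l K * Aᵀ = μ • J l K := by
    have := congrArg Neg.neg h3
    simpa only [neg_neg, Matrix.mul_assoc] using this
  exact h4

/-- The transpose of a similitude is a similitude (same multiplier). [cite: AndrianovZhuravlev1995, Ch. 3 §3] -/
theorem transposeGL_mem {g : GL (l ⊕ l) K} (hg : g ∈ symplecticSimilitudeGroup l K) :
    transposeGL g ∈ symplecticSimilitudeGroup l K := by
  obtain ⟨μ, hμ, hg⟩ := hg
  refine ⟨μ, hμ, ?_⟩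
  rw [coe_transposeGL, Matrix.transpose_transpose]
  exact mul_J_mul_transpose_of_eq g hg

/-- The contragredient of a similitude is a similitude. [cite: AndrianovZhuravlev1995, Ch. 3 §3] -/
theorem contragredientGL_mem {g : GL (l ⊕ l) K} (hg : g ∈ symplecticSimilitudeGroup l K) :
    contragredientGL g ∈ symplecticSimilitudeGroup l K :=
  transposeGL_mem ((symplecticSimilitudeGroup l K).inv_mem hg)

/-- **The contragredient automorphism of `GSp(J, K)`**, `g ↦ (gᵀ)⁻¹`. [cite: AndrianovZhuravlev1995, Ch. 3 §3] -/
def contragredientGSp : symplecticSimilitudeGroup l K ≃* symplecticSimilitudeGroup l K where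
  toFun g := ⟨contragredientGL g.1, contragredientGL_mem g.2⟩
  invFun g := ⟨contragredientGL g.1, contragredientGL_mem g.2⟩
  left_inv g := Subtype.ext (contragredientGL.left_inv g.1)
  right_inv g := Subtype.ext (contragredientGL.left_inv g.1)
  map_mul' g h := Subtype.ext (map_mul contragredientGL g.1 h.1)

/-- `contragredientGSp g = (gᵀ)⁻¹` on matrices. [cite: AndrianovZhuravlev1995, Ch. 3 §3] -/
theorem coe_contragredientGSp (g : symplecticSimilitudeGroup l K) :
    ((contragredientGSp g : symplecticSimilitudeGroup l K) : GL (l ⊕ l) K) = contragredientGL (g : GL (l ⊕ l) K) := rfl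

/-- **`Sp(J, K) → GSp(J, K)`**: a symplectic matrix as a similitude of multiplier `1` (the unit with inverse `A⁻¹ ∈ Sp`).
[cite: AndrianovZhuravlev1995, Ch. 3 §3] -/
def ofSymplectic : symplecticGroup l K →* symplecticSimilitudeGroup l K where
  toFun A := ⟨⟨(A : Matrix (l ⊕ l) (l ⊕ l) K), ((A⁻¹ : symplecticGroup l K) : Matrix (l ⊕ l) (l ⊕ l) K),
      by rw [← Submonoid.coe_mul, mul_inv_cancel]; rfl,
      by rw [← Submonoid.coe_mul, inv_mul_cancel]; rfl⟩,
    ⟨1, one_ne_zero, by rw [one_smul]; exact SymplecticGroup.mem_iff'.1 A.2⟩⟩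
  map_one' := Subtype.ext (Units.ext rfl)
  map_mul' A B := Subtype.ext (Units.ext rfl)

/-- The matrix of `ofSymplectic A` is `A`. [cite: AndrianovZhuravlev1995, Ch. 3 §3] -/
@[simp] theorem coe_ofSymplectic (A : symplecticGroup l K) :
    (((ofSymplectic A : symplecticSimilitudeGroup l K) : GL (l ⊕ l) K) : Matrix (l ⊕ l) (l ⊕ l) K) =
      (A : Matrix (l ⊕ l) (l ⊕ l) K) := rfl

/-! ## §3 The hyperspecial subgroup `GSp(J, 𝒪)` -/

section Valued

variable [Valued K ℤᵐ⁰] {ϖ : K}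

/-- **`GSp(J, 𝒪)`** — similitudes `g` with all entries of `g` and of `g⁻¹` in the valuation ring `𝒪` (so the multiplier is
a unit); the hyperspecial maximal compact subgroup of `GSp(J, K)` for `K` a local field.
[cite: AndrianovZhuravlev1995, Ch. 3 §3; Tits1979, §3.3.3] -/
def symplecticSimilitudeInt (l K : Type*) [Field K] [Valued K ℤᵐ⁰] [Fintype l] [DecidableEq l] :
    Subgroup (symplecticSimilitudeGroup l K) where
  carrier := {g | (∀ i j, Valued.v (((g : GL (l ⊕ l) K) : Matrix (l ⊕ l) (l ⊕ l) K) i j) ≤ 1) ∧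
    ∀ i j, Valued.v ((((g : GL (l ⊕ l) K)⁻¹ : GL (l ⊕ l) K) : Matrix (l ⊕ l) (l ⊕ l) K) i j) ≤ 1}
  one_mem' := by
    refine ⟨fun i j => ?_, fun i j => ?_⟩
    · rw [OneMemClass.coe_one, Units.val_one, Matrix.one_apply]
      split_ifs
      · rw [map_one]
      · rw [map_zero]; exact zero_le
    · rw [OneMemClass.coe_one, inv_one, Units.val_one, Matrix.one_apply]
      split_ifs
      · rw [map_one]
      · rw [map_zero]; exact zero_le
  mul_mem' := by
    rintro g h ⟨hg, hgi⟩ ⟨hh, hhi⟩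
    refine ⟨fun i j => ?_, fun i j => ?_⟩
    · rw [Subgroup.coe_mul, Units.val_mul]
      exact v_mul_apply_le_one hg hh i j
    · rw [Subgroup.coe_mul, _root_.mul_inv_rev, Units.val_mul]
      exact v_mul_apply_le_one hhi hgi i j
  inv_mem' := by
    rintro g ⟨hg, hgi⟩
    refine ⟨fun i j => ?_, fun i j => ?_⟩
    · rw [Subgroup.coe_inv]; exact hgi i j
    · rw [Subgroup.coe_inv, inv_inv]; exact hg i j

/-- Membership in `GSp(J, 𝒪)`. [cite: Tits1979, §3.3.3] -/
theorem mem_symplecticSimilitudeInt_iff {g : symplecticSimilitudeGroup l K} :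
    g ∈ symplecticSimilitudeInt l K ↔
      (∀ i j, Valued.v (((g : GL (l ⊕ l) K) : Matrix (l ⊕ l) (l ⊕ l) K) i j) ≤ 1) ∧
      ∀ i j, Valued.v ((((g : GL (l ⊕ l) K)⁻¹ : GL (l ⊕ l) K) : Matrix (l ⊕ l) (l ⊕ l) K) i j) ≤ 1 :=
  Iff.rfl

/-- `Sp(J, 𝒪) → GSp(J, 𝒪)`. [cite: Tits1979, §3.3.3] -/
theorem ofSymplectic_mem_symplecticSimilitudeInt {A : symplecticGroup l K} (hA : A ∈ symplecticInt l K) :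
    ofSymplectic A ∈ symplecticSimilitudeInt l K :=
  ⟨mem_symplecticInt_iff.1 hA, fun i j => v_inv_apply_le_one_of_mem_symplecticInt hA i j⟩

/-- `GSp(J, 𝒪)` is stable under transposition. [cite: AndrianovZhuravlev1995, Ch. 3 §3] -/
theorem transposeGL_mem_symplecticSimilitudeInt {g : symplecticSimilitudeGroup l K} (hg : g ∈ symplecticSimilitudeInt l K) :
    (⟨transposeGL (g : GL (l ⊕ l) K), transposeGL_mem g.2⟩ : symplecticSimilitudeGroup l K) ∈
      symplecticSimilitudeInt l K := by
  obtain ⟨h1, h2⟩ := hg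
  refine ⟨fun i j => ?_, fun i j => ?_⟩
  · show Valued.v (((transposeGL (g : GL (l ⊕ l) K) : GL (l ⊕ l) K) : Matrix (l ⊕ l) (l ⊕ l) K) i j) ≤ 1
    rw [coe_transposeGL, Matrix.transpose_apply]; exact h1 j i
  · show Valued.v ((((transposeGL (g : GL (l ⊕ l) K))⁻¹ : GL (l ⊕ l) K) : Matrix (l ⊕ l) (l ⊕ l) K) i j) ≤ 1
    rw [← transposeGL_inv, coe_transposeGL, Matrix.transpose_apply]; exact h2 j i

/-! ## §4 The Gelfand pair `(GSp(J, K), GSp(J, 𝒪))` -/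

/-- **Every double coset is transpose-stable**: for `g ∈ GSp(J, K)`, `g⁻¹ ∈ GSp(J, 𝒪) · (gᵀ)⁻¹ · GSp(J, 𝒪)` (equivalently
`gᵀ ∈ GSp(J, 𝒪) g GSp(J, 𝒪)`).  From the Cartan decomposition `g = k₁ T k₂` (`exists_cartan_decomposition_of_similitude`,
`T` diagonal, `kᵢ ∈ Sp(J, 𝒪)`): `g⁻¹ = (k₂⁻¹ k₁ᵀ) (gᵀ)⁻¹ (k₂ᵀ k₁⁻¹)`.
[cite: AndrianovZhuravlev1995, Ch. 3 §3, proof of Theorem 3.7; Tits1979, §3.3.3] -/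
theorem inv_mem_doubleCoset_contragredient (hϖ : Valued.v ϖ = WithZero.exp (-1 : ℤ))
    (g : symplecticSimilitudeGroup l K) :
    g⁻¹ ∈ DoubleCoset.doubleCoset (contragredientGSp g) (symplecticSimilitudeInt l K) (symplecticSimilitudeInt l K) := by
  obtain ⟨μ, hμ, hg⟩ := g.2
  obtain ⟨k₁, k₂, a, hk₁, hk₂, hdec⟩ := exists_cartan_decomposition_of_similitude hϖ hμ hg
  -- the players as elements of `GSp(J, K)`
  set K₁ : symplecticSimilitudeGroup l K := ofSymplectic k₁ with hK₁
  set K₂ : symplecticSimilitudeGroup l K := ofSymplectic k₂ with hK₂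
  set K₁t : symplecticSimilitudeGroup l K := ⟨transposeGL (K₁ : GL (l ⊕ l) K), transposeGL_mem K₁.2⟩ with hK₁t
  set K₂t : symplecticSimilitudeGroup l K := ⟨transposeGL (K₂ : GL (l ⊕ l) K), transposeGL_mem K₂.2⟩ with hK₂t
  have hK₁i : K₁ ∈ symplecticSimilitudeInt l K := ofSymplectic_mem_symplecticSimilitudeInt hk₁
  have hK₂i : K₂ ∈ symplecticSimilitudeInt l K := ofSymplectic_mem_symplecticSimilitudeInt hk₂
  have hK₁ti : K₁t ∈ symplecticSimilitudeInt l K := transposeGL_mem_symplecticSimilitudeInt hK₁i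
  have hK₂ti : K₂t ∈ symplecticSimilitudeInt l K := transposeGL_mem_symplecticSimilitudeInt hK₂i
  -- the diagonal middle factor `T = K₁⁻¹ g K₂⁻¹` (in `GSp`) is symmetric: `Tᵀ = T`
  set d : l ⊕ l → K := Sum.elim (fun i => μ * ϖ ^ a i) (fun i => ϖ ^ (-a i)) with hd
  have hgmat : ((g : GL (l ⊕ l) K) : Matrix (l ⊕ l) (l ⊕ l) K) =
      ((K₁ : GL (l ⊕ l) K) : Matrix _ _ K) * Matrix.diagonal d * ((K₂ : GL (l ⊕ l) K) : Matrix _ _ K) := hdec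
  have hT : (((K₁⁻¹ * g * K₂⁻¹ : symplecticSimilitudeGroup l K) : GL (l ⊕ l) K) : Matrix (l ⊕ l) (l ⊕ l) K) =
      Matrix.diagonal d := by
    have h1 : (((K₁⁻¹ : symplecticSimilitudeGroup l K) : GL (l ⊕ l) K) : Matrix (l ⊕ l) (l ⊕ l) K) *
        ((K₁ : GL (l ⊕ l) K) : Matrix _ _ K) = 1 := by
      rw [Subgroup.coe_inv, ← Units.val_mul, inv_mul_cancel, Units.val_one]
    have h2 : ((K₂ : GL (l ⊕ l) K) : Matrix _ _ K) *
        (((K₂⁻¹ : symplecticSimilitudeGroup l K) : GL (l ⊕ l) K) : Matrix (l ⊕ l) (l ⊕ l) K) = 1 := by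
      rw [Subgroup.coe_inv, ← Units.val_mul, mul_inv_cancel, Units.val_one]
    rw [Subgroup.coe_mul, Subgroup.coe_mul, Units.val_mul, Units.val_mul, hgmat]
    calc (((K₁⁻¹ : symplecticSimilitudeGroup l K) : GL (l ⊕ l) K) : Matrix (l ⊕ l) (l ⊕ l) K) *
          (((K₁ : GL (l ⊕ l) K) : Matrix _ _ K) * Matrix.diagonal d * ((K₂ : GL (l ⊕ l) K) : Matrix _ _ K)) *
          (((K₂⁻¹ : symplecticSimilitudeGroup l K) : GL (l ⊕ l) K) : Matrix (l ⊕ l) (l ⊕ l) K)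
        = ((((K₁⁻¹ : symplecticSimilitudeGroup l K) : GL (l ⊕ l) K) : Matrix (l ⊕ l) (l ⊕ l) K) *
            ((K₁ : GL (l ⊕ l) K) : Matrix _ _ K)) * Matrix.diagonal d *
            (((K₂ : GL (l ⊕ l) K) : Matrix _ _ K) *
              (((K₂⁻¹ : symplecticSimilitudeGroup l K) : GL (l ⊕ l) K) : Matrix (l ⊕ l) (l ⊕ l) K)) := by
          simp only [Matrix.mul_assoc]
      _ = Matrix.diagonal d := by rw [h1, h2, Matrix.one_mul, Matrix.mul_one]
  -- hence `(K₁⁻¹ g K₂⁻¹)ᵀ = K₁⁻¹ g K₂⁻¹`, i.e. `K₂t⁻¹ gᵀ K₁t⁻¹ = K₁⁻¹ g K₂⁻¹` in `GL`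
  have hTt : transposeGL ((K₁⁻¹ * g * K₂⁻¹ : symplecticSimilitudeGroup l K) : GL (l ⊕ l) K) =
      ((K₁⁻¹ * g * K₂⁻¹ : symplecticSimilitudeGroup l K) : GL (l ⊕ l) K) :=
    Units.ext (by rw [coe_transposeGL, hT, Matrix.diagonal_transpose])
  -- rewrite the left side of `hTt` as a product of transposes
  have hprod : transposeGL ((K₁⁻¹ * g * K₂⁻¹ : symplecticSimilitudeGroup l K) : GL (l ⊕ l) K) =
      (transposeGL (K₂ : GL (l ⊕ l) K))⁻¹ * transposeGL (g : GL (l ⊕ l) K) * (transposeGL (K₁ : GL (l ⊕ l) K))⁻¹ := by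
    rw [Subgroup.coe_mul, Subgroup.coe_mul, Subgroup.coe_inv, Subgroup.coe_inv, transposeGL_mul, transposeGL_mul,
      transposeGL_inv, transposeGL_inv, mul_assoc]
  -- conclude in the group `GSp(J, K)`
  refine DoubleCoset.mem_doubleCoset.2 ⟨K₂⁻¹ * K₁t, (symplecticSimilitudeInt l K).mul_mem
      ((symplecticSimilitudeInt l K).inv_mem hK₂i) hK₁ti, K₂t * K₁⁻¹, (symplecticSimilitudeInt l K).mul_mem hK₂ti
      ((symplecticSimilitudeInt l K).inv_mem hK₁i), ?_⟩
  apply Subtype.ext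
  show ((g⁻¹ : symplecticSimilitudeGroup l K) : GL (l ⊕ l) K) =
    ((K₂⁻¹ * K₁t * contragredientGSp g * (K₂t * K₁⁻¹) : symplecticSimilitudeGroup l K) : GL (l ⊕ l) K)
  rw [Subgroup.coe_mul, Subgroup.coe_mul, Subgroup.coe_mul, Subgroup.coe_mul, Subgroup.coe_inv, Subgroup.coe_inv,
    Subgroup.coe_inv, coe_contragredientGSp, contragredientGL_eq]
  show (g : GL (l ⊕ l) K)⁻¹ = (K₂ : GL (l ⊕ l) K)⁻¹ * transposeGL (K₁ : GL (l ⊕ l) K) *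
    (transposeGL (g : GL (l ⊕ l) K))⁻¹ * (transposeGL (K₂ : GL (l ⊕ l) K) * (K₁ : GL (l ⊕ l) K)⁻¹)
  -- from `hTt`/`hprod`: `gᵀ = K₂ᵀ (K₁⁻¹ g K₂⁻¹) K₁ᵀ`
  have hgt : transposeGL (g : GL (l ⊕ l) K) =
      transposeGL (K₂ : GL (l ⊕ l) K) * ((K₁ : GL (l ⊕ l) K)⁻¹ * (g : GL (l ⊕ l) K) * (K₂ : GL (l ⊕ l) K)⁻¹) *
        transposeGL (K₁ : GL (l ⊕ l) K) := by
    have h := hprod.symm.trans hTt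
    rw [Subgroup.coe_mul, Subgroup.coe_mul, Subgroup.coe_inv, Subgroup.coe_inv] at h
    rw [← h]; group
  rw [hgt]; group

/-- **`(GSp(J, K), GSp(J, 𝒪))` is a Gelfand pair**: the Hecke algebra `ℋ(GSp(J, K), GSp(J, 𝒪))` of the symplectic similitude
group relative to its hyperspecial subgroup is COMMUTATIVE (`K` discretely valued with a uniformiser; coefficients in any
commutative ring `k`).  Gelfand's trick with the contragredient automorphism `θ(g) = (gᵀ)⁻¹` (`g⁻¹ ∈ K₀ θ(g) K₀`, the tree's
`isGelfandPair_of_mulEquiv`). [cite: AndrianovZhuravlev1995, Ch. 3 §3, Theorem 3.7; Tits1979, §3.3.3; CeccherinisilbersteScarabottiTolli2018, Ex. 13.3.9] -/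
theorem isGelfandPair_symplecticSimilitudeInt (k : Type*) [CommRing k] (hϖ : Valued.v ϖ = WithZero.exp (-1 : ℤ)) :
    IsGelfandPair k (symplecticSimilitudeGroup l K) (symplecticSimilitudeInt l K) :=
  isGelfandPair_of_mulEquiv contragredientGSp fun g => inv_mem_doubleCoset_contragredient hϖ g

end Valued

end Literature.NumberTheory.Automorphic.SymplecticCartan

end
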